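import Literature.AlgebraicGeometry.Resolution.BlowupsLocal
import Mathlib.AlgebraicGeometry.Gluing
import HarnessLib

/-!
# Being a blowing up is local on the base

Topic: `Literature/AlgebraicGeometry/Resolution`. The converse of `IsBlowup.restrict`
(`Blowups.lean`, Görtz–Wedhorn Prop. 13.91): if `π : X' → X` restricts, over the members of an
open cover of `X`, to blowing ups along the restricted ideal sheaf, then `π` is a blowing up
(Stacks, Tag 0806 = Lemma 31.33.5 is proved there exactly by this gluing of the universal
property along affine opens). This is the gluing step needed to build global blowing ups from
the affine construction (`AffineBlowup.lean`). All PROVED: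

* `IsBlowup.hom_ext_of_range_subset` — uniqueness of lifts is local: two morphisms `a, b : T → X'`
  with the same composite `q = a ≫ π = b ≫ π` landing in an open `U` over which `π` is a blowing
  up, with `J.comap q` effective Cartier, are equal;
* `IsBlowup.of_openCover` — **being a blowing up is local on the base** (effective-Cartier half by
  `isEffectiveCartier_of_openCover`, `BlowupsLocal.lean`; universal half by gluing the local lifts
  with `Scheme.Cover.glueMorphisms` and `hom_ext_of_range_subset`).

## Sources

* The Stacks Project, Tag 0806 (Lemma 31.33.5, proof). [StacksProject]
* U. Görtz, T. Wedhorn, *Algebraic Geometry I*, Prop. 13.91. [GortzWedhorn2020]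
-/

noncomputable section

open CategoryTheory CategoryTheory.Limits AlgebraicGeometry TopologicalSpace

namespace Literature.AlgebraicGeometry.Resolution

universe u

variable {X' X : Scheme.{u}} {π : X' ⟶ X} {J : X.IdealSheafData}

/-- **Uniqueness of lifts is local on the base.** If `π` is a blowing up over the open `U ⊆ X`
and `a, b : T → X'` have the same composite `a ≫ π = b ≫ π` with image in `U` along which `J`
pulls back to an effective Cartier divisor, then `a = b`. [cite: StacksProject, Tag 0806] -/
theorem IsBlowup.hom_ext_of_range_subset (U : X.Opens) (hU : IsBlowup (π ∣_ U) (J.comap U.ι))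
    {T : Scheme.{u}} {a b : T ⟶ X'} (hab : a ≫ π = b ≫ π)
    (hrange : Set.range (a ≫ π) ⊆ (U : Set X)) (hcart : IsEffectiveCartier (J.comap (a ≫ π))) :
    a = b := by
  -- factor `a`, `b` through `π⁻¹(U)` and `a ≫ π` through `U`
  have hra : Set.range a ⊆ Set.range (π ⁻¹ᵁ U).ι := by
    rintro _ ⟨t, rfl⟩
    rw [Scheme.Opens.range_ι]
    exact hrange ⟨t, rfl⟩
  have hrb : Set.range b ⊆ Set.range (π ⁻¹ᵁ U).ι := by
    rintro _ ⟨t, rfl⟩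
    rw [Scheme.Opens.range_ι]
    change (b ≫ π) t ∈ U
    rw [← hab]
    exact hrange ⟨t, rfl⟩
  have hrq : Set.range (a ≫ π) ⊆ Set.range U.ι := by rwa [Scheme.Opens.range_ι]
  let a' := IsOpenImmersion.lift (π ⁻¹ᵁ U).ι a hra
  let b' := IsOpenImmersion.lift (π ⁻¹ᵁ U).ι b hrb
  let q' := IsOpenImmersion.lift U.ι (a ≫ π) hrq
  have ha' : a' ≫ (π ⁻¹ᵁ U).ι = a := IsOpenImmersion.lift_fac _ _ _
  have hb' : b' ≫ (π ⁻¹ᵁ U).ι = b := IsOpenImmersion.lift_fac _ _ _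
  have hq' : q' ≫ U.ι = a ≫ π := IsOpenImmersion.lift_fac _ _ _
  have ha'' : a' ≫ (π ∣_ U) = q' := by
    rw [← cancel_mono U.ι, Category.assoc, morphismRestrict_ι, ← Category.assoc, ha', hq']
  have hb'' : b' ≫ (π ∣_ U) = q' := by
    rw [← cancel_mono U.ι, Category.assoc, morphismRestrict_ι, ← Category.assoc, hb', hq', hab]
  have hcart' : IsEffectiveCartier ((J.comap U.ι).comap (a' ≫ (π ∣_ U))) := by
    rw [← Scheme.IdealSheafData.comap_comp, ha'', hq']
    exact hcart
  have : a' = b' := hU.hom_ext hcart' (by rw [ha'', hb''])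
  rw [← ha', ← hb', this]

/-- **Being a blowing up is local on the base**: if `π : X' → X` restricts over every member
`Uᵢ` of an open cover of `X` to a blowing up of `Uᵢ` along `J|_{Uᵢ}`, then `π` is a blowing up
of `X` along `J` (Stacks 0806: the universal property glues).
[cite: StacksProject, Tag 0806] -/
theorem IsBlowup.of_openCover (𝒰 : X.OpenCover)
    (h : ∀ i, IsBlowup (π ∣_ (𝒰.f i).opensRange) (J.comap (𝒰.f i).opensRange.ι)) :
    IsBlowup π J := by
  -- the opens `Uᵢ` and their preimages
  let U : 𝒰.I₀ → X.Opens := fun i => (𝒰.f i).opensRange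
  have hU : ⨆ i, U i = ⊤ := 𝒰.iSup_opensRange
  constructor
  · -- effective Cartier: local on `X'`, over the cover `π⁻¹(Uᵢ)`
    refine isEffectiveCartier_of_openCover (J.comap π)
      (X'.openCoverOfIsOpenCover (fun i => π ⁻¹ᵁ U i) (.mk (π.iSup_preimage_eq_top hU))) ?_
    intro i
    change IsEffectiveCartier ((J.comap π).comap (π ⁻¹ᵁ U i).ι)
    rw [← Scheme.IdealSheafData.comap_comp, ← morphismRestrict_ι, Scheme.IdealSheafData.comap_comp]
    exact (h i).isEffectiveCartier
  · -- universality: glue the local lifts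
    intro W f hf
    let V : 𝒰.I₀ → W.Opens := fun i => f ⁻¹ᵁ U i
    have hV : ⨆ i, V i = ⊤ := f.iSup_preimage_eq_top hU
    let 𝒱 := W.openCoverOfIsOpenCover V (.mk hV)
    -- local lifts
    have hcart : ∀ i, IsEffectiveCartier ((J.comap (U i).ι).comap (f ∣_ U i)) := fun i => by
      rw [← Scheme.IdealSheafData.comap_comp, morphismRestrict_ι, Scheme.IdealSheafData.comap_comp]
      exact hf.comap_ι (V i)
    let g : ∀ i, (V i : Scheme.{u}) ⟶ X' := fun i =>
      (h i).lift (f ∣_ U i) (hcart i) ≫ (π ⁻¹ᵁ U i).ι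
    have hgπ : ∀ i, g i ≫ π = (V i).ι ≫ f := fun i => by
      change ((h i).lift (f ∣_ U i) (hcart i) ≫ (π ⁻¹ᵁ U i).ι) ≫ π = _
      rw [Category.assoc, ← morphismRestrict_ι, ← Category.assoc, (h i).lift_comp, morphismRestrict_ι]
    -- compatibility on overlaps, by local uniqueness over `Uᵢ`
    have hcompat : ∀ i j : 𝒰.I₀,
        pullback.fst ((V i).ι) ((V j).ι) ≫ g i = pullback.snd _ _ ≫ g j := by
      intro i j
      have e : (pullback.fst ((V i).ι) ((V j).ι) ≫ g i) ≫ π =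
          (pullback.snd ((V i).ι) ((V j).ι) ≫ g j) ≫ π := by
        rw [Category.assoc, hgπ i, Category.assoc, hgπ j, ← Category.assoc, ← Category.assoc,
          pullback.condition]
      refine IsBlowup.hom_ext_of_range_subset (U i) (h i) e ?_ ?_
      · rintro _ ⟨t, rfl⟩
        have : ((pullback.fst ((V i).ι) ((V j).ι) ≫ g i) ≫ π) t =
            f ((V i).ι (pullback.fst ((V i).ι) ((V j).ι) t)) := by
          rw [Category.assoc, hgπ i]; rfl
        rw [this]
        exact (pullback.fst ((V i).ι) ((V j).ι) t).2
      · rw [Category.assoc, hgπ i, ← Category.assoc, Scheme.IdealSheafData.comap_comp,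
          Scheme.IdealSheafData.comap_comp]
        exact (hf.comap_ι (V i)).comap_of_isOpenImmersion _
    -- the glued lift
    refine ⟨𝒱.glueMorphisms g hcompat, ?_, ?_⟩
    · apply Scheme.Cover.hom_ext 𝒱
      intro i
      change (V i).ι ≫ 𝒱.glueMorphisms g hcompat ≫ π = (V i).ι ≫ f
      rw [← Category.assoc]
      have : (V i).ι ≫ 𝒱.glueMorphisms g hcompat = g i := Scheme.Cover.ι_glueMorphisms 𝒱 g hcompat i
      rw [this, hgπ i]
    · intro g' hg'
      apply Scheme.Cover.hom_ext 𝒱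
      intro i
      change (V i).ι ≫ g' = (V i).ι ≫ 𝒱.glueMorphisms g hcompat
      have hgl : (V i).ι ≫ 𝒱.glueMorphisms g hcompat = g i :=
        Scheme.Cover.ι_glueMorphisms 𝒱 g hcompat i
      rw [hgl]
      have e : ((V i).ι ≫ g') ≫ π = g i ≫ π := by rw [Category.assoc, hg', hgπ i]
      refine IsBlowup.hom_ext_of_range_subset (U i) (h i) e ?_ ?_
      · rintro _ ⟨t, rfl⟩
        have : (((V i).ι ≫ g') ≫ π) t = f ((V i).ι t) := by rw [Category.assoc, hg']; rfl
        rw [this]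
        exact t.2
      · rw [Category.assoc, hg', Scheme.IdealSheafData.comap_comp]
        exact hf.comap_ι (V i)

end Literature.AlgebraicGeometry.Resolution

end
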